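import Summits.CriticalPhenomena.PercolationContinuityZ3.Theorems.Transplant.SkelNeg1FaceHoldsAF
import Summits.CriticalPhenomena.PercolationContinuityZ3.Theorems.Transplant.SkelNeg1FaceFloorsPkgAK
import HarnessLib

/-!
# N1 (the `{±1}` node), (F) column — **THE UNCONDITIONAL (F) DISCHARGER AT SLOT-LEDGER (ζ′) v3, BY NAME** (readability corollary, filed AFTER the node₁ file
# `SkelNeg1HoldsAllL` p329520 per lead (g9) 12:02Z (1)): `NegB.faceHoldsRNOFnL_negChoiceAllOTA_K : FaceHoldsRNOFnL NegB.LfA (negChoiceAllOTA (KS.gT 0 KS.gxAK)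
# (KS.fT 0 KS.fxA) (KS.PR 0 KS.PxFK) (SUA exAFK mxRA))` := hp-8 g36's glue `…_AFK` (SkelNeg1FaceHoldsAF p328012) applied to the three M3 floor packages
# `floorsPkgS_AK / floorsPkgD_AK / floorsPkgT_AK` (SkelNeg1FaceFloorsPkgAK p328946).  The node₁ file uses the same term inline; this name is for customers
# and audits that want the (F) hypothesis of the closure `samePDropOfSkeletonNeg₁_of_choiceFnNOWL` as one declaration, like Geom/(R)/(C).  (stmt-g17 2026-08-22.)
builds on p205010 (kernel theorem, internal audit signed; external expert review pending) — NOTHING new is claimed here: the node's status is that of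
`SkelNeg1HoldsAllL` (ACCEPTED; internal audit V112 (6) in progress; external expert review pending).
Lane `prim-bschramm-*`, seat `prim-bschramm-stmt` (gen 17); helper file (`--supports stmt-CriticalPhenomena-4575 --as helper`).
[cite: KozmaNitzan2024, §4 Lemma 12 (pp. 23–25), Theorem 6 (pp. 25–31)] [cite: MartineauTassion2017, §4.3]
-/

noncomputable section

namespace Summit.CriticalPhenomena.PercolationContinuityZ3.Theorems.Transplant

namespace PlanarSkeletonNeg

namespace NegB

/-- **(F) at slot-ledger (ζ′) v3, unconditional**: the face/bridge hypothesis `FaceHoldsRNOFnL NegB.LfA` of the closure of record for the choice function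
`negChoiceAllOTA (KS.gT 0 KS.gxAK) (KS.fT 0 KS.fxA) (KS.PR 0 KS.PxFK) (SUA exAFK mxRA)` — the glue `…_AFK` on the three M3 floor packages.
[cite: KozmaNitzan2024, §4 Lemma 12 (pp. 23–25), Theorem 6 (pp. 25–31)] -/
theorem faceHoldsRNOFnL_negChoiceAllOTA_K :
    FaceHoldsRNOFnL NegB.LfA (negChoiceAllOTA (KS.gT 0 KS.gxAK) (KS.fT 0 KS.fxA) (KS.PR 0 KS.PxFK) (SUA exAFK mxRA)) :=
  faceHoldsRNOFnL_negChoiceAllOTA_AFK floorsPkgS_AK floorsPkgD_AK floorsPkgT_AK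

end NegB

end PlanarSkeletonNeg

end Summit.CriticalPhenomena.PercolationContinuityZ3.Theorems.Transplant

end
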